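/-
Copyright (c) 2026 the pub-hodgecm-mathlib formalisation cell (harness21).  Prover seat hodgecm-mathlib-LH4-p11 (g5), req620 Track A «(D-RAM) FOUR-FRAME» squad
(unit U2H_HSide, the (ρ2b′-X) road :418; payer by lineage LH4-p14 (g4) 2026-09-04T05:51:39Z «(C⁗) — yes please: fold ★ (β) so the cone terms read q_w^b·#levelSetDep»).
-/
import Summits.HodgeConjecture.HodgeConjecture.Theorems.F0P3cDyRamFixedPointCensusTypeTwoCensusOfOrderForms   -- (this seat, part 2): (C‴) → (C″⁺); brings part 1, ★ (C1), ★ Prelude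
import Summits.HodgeConjecture.HodgeConjecture.Theorems.F0P3cDyRamConeWeightHalfSplit                     -- ★ p857610∕p857697 (this seat): (β) `finsum_levelSetDep_weight_eq_pow_mul_ncard`, ED. 2 `exists_flipUnit_of_forall_fixed_fixed_isNorm`
import HarnessLib

/-!
# F0 · P3c · line LH4 «(D-RAM) FOUR-FRAME» — unit (ii-H), leaf (ρ2b′-X): SOCKET (C‴) FROM SOCKET (C⁗) — the order-form census with its CONE WEIGHTS SUMMED: `q_w^b · #levelSetDep`

Cell `pub/hodgecm-mathlib`, crux H413 = `stmt-HodgeConjecture-24833` (helper lane, count-neutral); THEOREMS ONLY (no definition, no instance, no notation, no named fact, no `sorry`,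
default heartbeats outside the statement budget), typed under the LINE FILE's scopes.  Socket chain of the (ρ2b′-X) payer (LH4-p14 (g4) MAP v2): … ⟸ (C″) `SOCKET-hLM.v1` 66b80571 ⟸
[payer (C0b-1½)] ⟸ (C″⁺) ⟸ (C‴) [part 2] ⟸ **(C⁗) — THIS FILE**.

WHAT IS PROVED (v3∕v2 sockets of the payer's WORD «A11 STRIKE + hFN DOWN» 06:16Z — A11 struck, `hFN` now the first CONJUNCT of (C⁗)'s conclusion; this is the ★ p857805 head re-cut, in its own file for the 400-line cap): **`orderFormCensus3_of_orderCountCensus2 (tE) (hD) (h2v) (hOC : ‹(C⁗) v2›) : ‹(C‴) v3›`** (texts `F0/P3c/LH4/LH4-p14/g4/v3/SOCKET-hOC.v2` 220f9860 ∕ `SOCKET-hOF.v3` 4e801bec); below, the v1 description: (C⁗)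
(`F0/P3c/LH4/LH4-p11/g5/SOCKET-hOC.v1.LH4p11g5.txt`) = (C‴) (`SOCKET-hOF.v2`) with, in BOTH order forms of the conclusion, the cone summand `Σᶠ_{Λ ∈ levelSetDep_h(j,b;μ)} f b j Λ` REPLACED by
the closed count `Nat.card 𝓀[L_w] ^ b * (levelSetDep_h(j,b;μ)).ncard` (resp. `h′`) — the `q^a · dep_s(j, a; m)` currency of ★ T5s (p857461 ∕ p857711); antecedents identical to
(C‴)'s (so the weights `f, f′` are now idle letters the (C⁗)-prover may ignore).  PROOF: per `(b, j)` cell with `b ≥ 1` and `lam ∈ 𝒪_j`, ★ (β) `finsum_levelSetDep_weight_eq_pow_mul_ncard`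
at `E := L_w` (complete, DVR integers, finite residue field — :418's place; `hD`, `h2v` = :418's own datum letters, OUTER hypotheses here) with the flip unit produced from the
socket's `hFN` clause by ★ (β) ED. 2 `exists_flipUnit_of_forall_fixed_fixed_isNorm`, once for `(h, (Φ₂)_w, 1, f)` and once for `(h′, diag dg, η, f′)`.
So after this file the (C) leg's open content is (C⁗): T5 level tables (`#levelSet(j,0)`, `#levelSetDep(j,b;μ)`) of the two line models + the token∕sign letters — no lattice of
`L_w³`, no glue fibre, no weight.

HONEST LABEL: HC_CM is proved only modulo the 7 printed citations (2 remaining named inputs: hLiu418 = stmt-HodgeConjecture-24832, h413 = stmt-HodgeConjecture-24833) until rung 0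
closes; this file is a reduction (count-neutral) — (C⁗) is the OPEN order-count census socket; nothing in it is asserted here.

## References
* [Kottwitz1986BaseChangeUnits] R. E. Kottwitz, *Base change for unit elements of Hecke algebras*, Compositio Math. 60 (1986), §1 pp. 240–241.
* [Rogawski1990] J. D. Rogawski, *Automorphic Representations of Unitary Groups in Three Variables*, Ann. of Math. Stud. 123 (1990), §4.9 Prop. 4.9.1 (b) p. 55, Lemma 4.9.3 p. 56.
* [Serre1979] J.-P. Serre, *Local Fields*, GTM 67 (1979), Ch. V §3 Prop. 5, Cor. 2–3 pp. 84–86 (norm groups of a ramified quadratic extension).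
* [LabesseLanglands1979] J.-P. Labesse, R. P. Langlands, *L-indistinguishability for SL(2)*, Canad. J. Math. 31 (1979), §2 p. 8.
-/

set_option autoImplicit false

noncomputable section

namespace Summit.HodgeConjecture.HodgeConjecture.Cruxes.H413.F0P3cDyRamFixedPointCensusTypeTwoCensusOfOrderCountsV3

-- THE LINES MODULE'S `open` CONTEXT (tree `Cruxes/H413/Lines/F0_P3c_DyRamFourFrame_U2H_HSide.lean`, after its `namespace`) — WITHOUT `ValuativeRel` (the `𝒪[·] ⧸ 𝓂[·]`, `𝓀[·]`
-- tokens are ★ T1's `Valued` spelling):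
open MeasureTheory Measure NumberField IsDedekindDomain Topology Filter
open Literature.NumberTheory.Automorphic Literature.NumberTheory.Automorphic.UnitaryGroup Literature.NumberTheory.Automorphic.IntegralReduction
open Literature.NumberTheory.Rogawski1990 Literature.NumberTheory.GaloisRepresentations
open Literature.NumberTheory.Automorphic.UnitaryThreeFourFrame
open scoped Matrix MatrixGroups Classical Valued
open Literature.NumberTheory.Automorphic.UnitaryLatticeTree Literature.NumberTheory.Automorphic.HermitianLattice
open Literature.NumberTheory.QuadraticForms
open Summit.HodgeConjecture.HodgeConjecture.Cruxes.H413.F0P3cDyRamToricCensusDefs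
open Summit.HodgeConjecture.HodgeConjecture.Cruxes.H413.F0P3cDyRamConeWeightHalfSplit

/-! ## (v3 sockets) the v3∕v2 sockets (payer WORD «A11 STRIKE + hFN DOWN», 2026-09-04T06:16Z): A11 struck; `hFN` is now the FIRST CONJUNCT of (C⁗)'s conclusion (the bottom census prover,
who splits by descent type, proves it), and the flip unit of ★ (β) ED. 2 is produced from it here -/

set_option maxHeartbeats 800000 in
-- budget only: statement-heavy tokens (two nested sockets over a quadratic number field and two line models).
/-- **SOCKET (C‴) v3 FROM SOCKET (C⁗) v2** (`F0/P3c/LH4/LH4-p14/g4/v3/SOCKET-hOF.v3.LH4p14g4.txt` 4e801bec ⟸ `…/SOCKET-hOC.v2.LH4p14g4.txt` 220f9860 = this file's v1 texts with the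
A11 line deleted, the `hFN` antecedent deleted, and (C⁗)'s tail wrapped as `hFN ∧ (∀ m β, …)`): the cone weights of both order forms summed by ★ (β) with the flip unit produced
from the conjunct `hFN` by ★ (β) ED. 2 — proof = the ED. 1 proof with `obtain ⟨hFN, hrest⟩`. [cite: Kottwitz1986BaseChangeUnits, §1 pp. 240–241] [cite: Serre1979, Ch. V §3 Prop. 5, Cor. 2–3 pp. 84–86]
[cite: LabesseLanglands1979, §2 p. 8] [cite: Rogawski1990, §4.9 Lemma 4.9.3 p. 56] -/
theorem orderFormCensus3_of_orderCountCensus2 (L : Type) [Field L] [NumberField L] [IsCMField L]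
    {v : HeightOneSpectrum (𝓞 ↥(maximalRealSubfield L))} (w : UnitaryGroup.PlacesOver L v)
    (hw : IsCMField.complexConj L • w.1 = w.1) (ϖ : (w.1.adicCompletion L)) (hϖ : Valued.v ϖ = WithZero.exp (-1 : ℤ)) (d tE : ℕ)
    (hD : IsRamifiedQuadraticDatum (galAdicCompletionMap (L := L) (IsCMField.complexConj L) hw) ϖ d tE) (h2v : Valued.v (2 : (w.1.adicCompletion L)) < 1)
    [Fintype (Valued.ResidueField (w.1.adicCompletion L))]
    (hOC :
      ∃ V ∈ 𝓝 (1 : ((UnitaryGroup.cmDatum L 2 (Matrix.of fun i j : Fin 2 => if i.val + j.val + 1 = 2 then (1 : L) else 0)).Local v × (UnitaryGroup.cmDatum L 1 (Matrix.of fun i j : Fin 1 => if i.val + j.val + 1 = 1 then (1 : L) else 0)).Local v)), ∀ γH ∈ V, IsLocalGRegular L v γH →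
        ¬ (∃ x : (w.1.adicCompletion L), (((((γH).1.val : GL (Fin 2) (UnitaryGroup.LocalRing L v)).val.map (Pi.evalRingHom (fun w' : UnitaryGroup.PlacesOver L v => w'.1.adicCompletion L) w))).charpoly).IsRoot x) →
        ∀ (E' : Type) [Field E'] [NumberField E'] [Algebra L E'] [Algebra.IsQuadraticExtension L E'] (c₁ : E' ≃ₐ[L] E') (δ : E') (m₀ : L)
          (s : (w.1.adicCompletion L)) (w₁ : UnitaryGroup.PlacesOver E' w.1) (hw₁ : c₁ • w₁.1 = w₁.1)
          (Θ : (w₁.1.adicCompletion E') →+* (w₁.1.adicCompletion E')) (α lam : (w₁.1.adicCompletion E')),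
          c₁ ≠ 1 → c₁ δ = -δ → δ ≠ 0 → algebraMap L E' m₀ = δ ^ 2 → s ≠ 0 →
          (((γH.1.val : GL (Fin 2) (UnitaryGroup.LocalRing L v)).val.map (Pi.evalRingHom (fun w' : UnitaryGroup.PlacesOver L v => w'.1.adicCompletion L) w))).trace * (((γH.1.val : GL (Fin 2) (UnitaryGroup.LocalRing L v)).val.map (Pi.evalRingHom (fun w' : UnitaryGroup.PlacesOver L v => w'.1.adicCompletion L) w))).trace - 4 * (((γH.1.val : GL (Fin 2) (UnitaryGroup.LocalRing L v)).val.map (Pi.evalRingHom (fun w' : UnitaryGroup.PlacesOver L v => w'.1.adicCompletion L) w))).det = s * s * ((m₀ : L) : (w.1.adicCompletion L)) →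
          (((γH.1.val : GL (Fin 2) (UnitaryGroup.LocalRing L v)).val.map (Pi.evalRingHom (fun w' : UnitaryGroup.PlacesOver L v => w'.1.adicCompletion L) w))).det * (galAdicCompletionMap (L := L) (IsCMField.complexConj L) hw) (((γH.1.val : GL (Fin 2) (UnitaryGroup.LocalRing L v)).val.map (Pi.evalRingHom (fun w' : UnitaryGroup.PlacesOver L v => w'.1.adicCompletion L) w))).det = 1 → (((γH.1.val : GL (Fin 2) (UnitaryGroup.LocalRing L v)).val.map (Pi.evalRingHom (fun w' : UnitaryGroup.PlacesOver L v => w'.1.adicCompletion L) w))).trace = (((γH.1.val : GL (Fin 2) (UnitaryGroup.LocalRing L v)).val.map (Pi.evalRingHom (fun w' : UnitaryGroup.PlacesOver L v => w'.1.adicCompletion L) w))).det * (galAdicCompletionMap (L := L) (IsCMField.complexConj L) hw) (((γH.1.val : GL (Fin 2) (UnitaryGroup.LocalRing L v)).val.map (Pi.evalRingHom (fun w' : UnitaryGroup.PlacesOver L v => w'.1.adicCompletion L) w))).trace →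
          (∀ x : (w.1.adicCompletion L), x * x - (((γH.1.val : GL (Fin 2) (UnitaryGroup.LocalRing L v)).val.map (Pi.evalRingHom (fun w' : UnitaryGroup.PlacesOver L v => w'.1.adicCompletion L) w))).trace * x + (((γH.1.val : GL (Fin 2) (UnitaryGroup.LocalRing L v)).val.map (Pi.evalRingHom (fun w' : UnitaryGroup.PlacesOver L v => w'.1.adicCompletion L) w))).det ≠ 0) →
          (∀ z, galAdicCompletionMap (L := E') c₁ hw₁ (galAdicCompletionMap (L := E') c₁ hw₁ z) = z) →
          (∀ z, Valued.v (galAdicCompletionMap (L := E') c₁ hw₁ z) = Valued.v z) →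
          (∀ a, galAdicCompletionMap (L := E') c₁ hw₁ (toPlace w.1 w₁ a) = toPlace w.1 w₁ a) →
          (∀ a, Valued.v (toPlace w.1 w₁ a) ≤ 1 ↔ Valued.v a ≤ 1) →
          (∀ z : (w₁.1.adicCompletion E'), galAdicCompletionMap (L := E') c₁ hw₁ z = z ↔ ∃ a, toPlace w.1 w₁ a = z) →
          (∀ a, Θ (toPlace w.1 w₁ a) = toPlace w.1 w₁ ((galAdicCompletionMap (L := L) (IsCMField.complexConj L) hw) a)) →
          (∀ z, Θ (Θ z) = z) →
          (∀ z, Θ (galAdicCompletionMap (L := E') c₁ hw₁ z) = galAdicCompletionMap (L := E') c₁ hw₁ (Θ z)) →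
          (∀ z, Valued.v (Θ z) = Valued.v z) →
          galAdicCompletionMap (L := E') c₁ hw₁ α ≠ α →
          Valued.v α ≤ 1 →
          (∀ z : (w₁.1.adicCompletion E'), Valued.v z ≤ 1 → Valued.v ((z - galAdicCompletionMap (L := E') c₁ hw₁ z) / (α - galAdicCompletionMap (L := E') c₁ hw₁ α)) ≤ 1) →
          2 * lam = toPlace w.1 w₁ (((γH.1.val : GL (Fin 2) (UnitaryGroup.LocalRing L v)).val.map (Pi.evalRingHom (fun w' : UnitaryGroup.PlacesOver L v => w'.1.adicCompletion L) w))).trace + toPlace w.1 w₁ s * ((δ : E') : (w₁.1.adicCompletion E')) →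
          lam * lam = toPlace w.1 w₁ (((γH.1.val : GL (Fin 2) (UnitaryGroup.LocalRing L v)).val.map (Pi.evalRingHom (fun w' : UnitaryGroup.PlacesOver L v => w'.1.adicCompletion L) w))).trace * lam - toPlace w.1 w₁ (((γH.1.val : GL (Fin 2) (UnitaryGroup.LocalRing L v)).val.map (Pi.evalRingHom (fun w' : UnitaryGroup.PlacesOver L v => w'.1.adicCompletion L) w))).det →
          galAdicCompletionMap (L := E') c₁ hw₁ lam = toPlace w.1 w₁ (((γH.1.val : GL (Fin 2) (UnitaryGroup.LocalRing L v)).val.map (Pi.evalRingHom (fun w' : UnitaryGroup.PlacesOver L v => w'.1.adicCompletion L) w))).trace - lam →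
          Θ lam * lam = 1 →
          Valued.v lam = 1 →
          (∀ z : (w₁.1.adicCompletion E'), ∃! pq : (w.1.adicCompletion L) × (w.1.adicCompletion L), z = toPlace w.1 w₁ pq.1 + toPlace w.1 w₁ pq.2 * lam) →
          ∀ (th ta : ((UnitaryGroup.cmDatum L 3 (Matrix.of fun i j : Fin 3 => if i.val + j.val + 1 = 3 then (1 : L) else 0)).Local v)) (P₁ : GL (Fin 3) (w.1.adicCompletion L)) (dg : Fin 2 → (w.1.adicCompletion L)) (η : (w.1.adicCompletion L)) (γ₁ : GL (Fin 2) (w.1.adicCompletion L)),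
            ((localNonsplitEquiv (IsCMField.complexConj L) (Matrix.of fun i j : Fin 3 => if i.val + j.val + 1 = 3 then (1 : L) else 0) (IsCMField.complexConj_ne_one L) w hw th : ↥(unitaryGroupOfForm (galAdicCompletionMap (L := L) (IsCMField.complexConj L) hw) (placeForm (Matrix.of fun i j : Fin 3 => if i.val + j.val + 1 = 3 then (1 : L) else 0) w.1))) : GL (Fin 3) (w.1.adicCompletion L)) = endoGL (((localNonsplitEquiv (IsCMField.complexConj L) (Matrix.of fun i j : Fin 2 => if i.val + j.val + 1 = 2 then (1 : L) else 0) (IsCMField.complexConj_ne_one L) w hw γH.1 : ↥(unitaryGroupOfForm (galAdicCompletionMap (L := L) (IsCMField.complexConj L) hw) (placeForm (Matrix.of fun i j : Fin 2 => if i.val + j.val + 1 = 2 then (1 : L) else 0) w.1))) : GL (Fin 2) (w.1.adicCompletion L)), ((localNonsplitEquiv (IsCMField.complexConj L) (Matrix.of fun i j : Fin 1 => if i.val + j.val + 1 = 1 then (1 : L) else 0) (IsCMField.complexConj_ne_one L) w hw γH.2).val : GL (Fin 1) (w.1.adicCompletion L))) →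
            ((localNonsplitEquiv (IsCMField.complexConj L) (Matrix.of fun i j : Fin 3 => if i.val + j.val + 1 = 3 then (1 : L) else 0) (IsCMField.complexConj_ne_one L) w hw ta : ↥(unitaryGroupOfForm (galAdicCompletionMap (L := L) (IsCMField.complexConj L) hw) (placeForm (Matrix.of fun i j : Fin 3 => if i.val + j.val + 1 = 3 then (1 : L) else 0) w.1))) : GL (Fin 3) (w.1.adicCompletion L)) = P₁ * endoGL (γ₁, ((localNonsplitEquiv (IsCMField.complexConj L) (Matrix.of fun i j : Fin 1 => if i.val + j.val + 1 = 1 then (1 : L) else 0) (IsCMField.complexConj_ne_one L) w hw γH.2).val : GL (Fin 1) (w.1.adicCompletion L))) * P₁⁻¹ →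
            formCongr (galAdicCompletionMap (L := L) (IsCMField.complexConj L) hw) P₁ (placeForm (Matrix.of fun i j : Fin 3 => if i.val + j.val + 1 = 3 then (1 : L) else 0) w.1) = (!![(Matrix.diagonal dg) 0 0, 0, (Matrix.diagonal dg) 0 1; 0, η, 0; (Matrix.diagonal dg) 1 0, 0, (Matrix.diagonal dg) 1 1] : Matrix (Fin 3) (Fin 3) (w.1.adicCompletion L)) →
            (∀ i, Valued.v (dg i) = 1) →
            (∀ i, (galAdicCompletionMap (L := L) (IsCMField.complexConj L) hw) (dg i) = dg i) →
            (galAdicCompletionMap (L := L) (IsCMField.complexConj L) hw) η = η →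
            Valued.v η = 1 →
            (¬ ∃ t : (w.1.adicCompletion L), t * (galAdicCompletionMap (L := L) (IsCMField.complexConj L) hw) t = η) →
            γ₁ ∈ unitaryGroupOfForm (galAdicCompletionMap (L := L) (IsCMField.complexConj L) hw) (Matrix.diagonal dg) →
            (γ₁ : Matrix (Fin 2) (Fin 2) (w.1.adicCompletion L)).charpoly = (((γH.1.val : GL (Fin 2) (UnitaryGroup.LocalRing L v)).val.map (Pi.evalRingHom (fun w' : UnitaryGroup.PlacesOver L v => w'.1.adicCompletion L) w))).charpoly →
          ∀ (φ : (Fin 2 → (w.1.adicCompletion L)) →+ (w₁.1.adicCompletion E')) (h : (w₁.1.adicCompletion E')) (φ' : (Fin 2 → (w.1.adicCompletion L)) →+ (w₁.1.adicCompletion E')) (h' : (w₁.1.adicCompletion E')),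
            (∀ (c : (w.1.adicCompletion L)) (x : Fin 2 → (w.1.adicCompletion L)), φ (c • x) = toPlace w.1 w₁ c * φ x) →
            Function.Injective φ →
            Function.Surjective φ →
            (∀ x, φ ((((localNonsplitEquiv (IsCMField.complexConj L) (Matrix.of fun i j : Fin 2 => if i.val + j.val + 1 = 2 then (1 : L) else 0) (IsCMField.complexConj_ne_one L) w hw γH.1 : ↥(unitaryGroupOfForm (galAdicCompletionMap (L := L) (IsCMField.complexConj L) hw) (placeForm (Matrix.of fun i j : Fin 2 => if i.val + j.val + 1 = 2 then (1 : L) else 0) w.1))) : GL (Fin 2) (w.1.adicCompletion L)) : Matrix (Fin 2) (Fin 2) (w.1.adicCompletion L)).mulVec x) = lam * φ x) →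
            (∀ x y, toPlace w.1 w₁ (pairing (galAdicCompletionMap (L := L) (IsCMField.complexConj L) hw) (placeForm (Matrix.of fun i j : Fin 2 => if i.val + j.val + 1 = 2 then (1 : L) else 0) w.1) x y) = h * Θ (φ x) * φ y + galAdicCompletionMap (L := E') c₁ hw₁ (h * Θ (φ x) * φ y)) →
            Θ h = h →
            h ≠ 0 →
            (∃ x : (w₁.1.adicCompletion E'), x ≠ 0 ∧ h * Θ x * x + galAdicCompletionMap (L := E') c₁ hw₁ (h * Θ x * x) = 0) →
            (∀ (c : (w.1.adicCompletion L)) (x : Fin 2 → (w.1.adicCompletion L)), φ' (c • x) = toPlace w.1 w₁ c * φ' x) →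
            Function.Injective φ' →
            Function.Surjective φ' →
            (∀ x, φ' ((γ₁ : Matrix (Fin 2) (Fin 2) (w.1.adicCompletion L)).mulVec x) = lam * φ' x) →
            (∀ x y, toPlace w.1 w₁ (pairing (galAdicCompletionMap (L := L) (IsCMField.complexConj L) hw) (Matrix.diagonal dg) x y) = h' * Θ (φ' x) * φ' y + galAdicCompletionMap (L := E') c₁ hw₁ (h' * Θ (φ' x) * φ' y)) →
            Θ h' = h' →
            h' ≠ 0 →
            (∀ (t : (w.1.adicCompletion L)) (n : ℤ), Valued.v (toPlace w.1 w₁ t) = Valued.v (toPlace w.1 w₁ ϖ) ^ n ↔ Valued.v t = Valued.v ϖ ^ n) →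
            (∀ c : (w₁.1.adicCompletion E'), galAdicCompletionMap (L := E') c₁ hw₁ c = c → c ≠ 0 → Valued.v c ≤ 1 → ∃ n : ℕ, Valued.v c = Valued.v (toPlace w.1 w₁ ϖ) ^ n) →
            (∀ t : (w₁.1.adicCompletion E'), galAdicCompletionMap (L := E') c₁ hw₁ t = t → Valued.v t < 1 → Valued.v t ≤ Valued.v (toPlace w.1 w₁ ϖ)) →
              ∀ (J R R' : ℕ) (f f' : ℕ → ℕ → AddSubgroup (w₁.1.adicCompletion E') → ℕ),
              {M₃ : Submodule (Valued.integer (w.1.adicCompletion L)) (Fin 3 → (w.1.adicCompletion L)) | IsVertexLattice (galAdicCompletionMap (L := L) (IsCMField.complexConj L) hw) ϖ ((StdForm.antidiagonal 3).over (w.1.adicCompletion L)) 0 M₃ ∧ mapGL (endoGL (((localNonsplitEquiv (IsCMField.complexConj L) (Matrix.of fun i j : Fin 2 => if i.val + j.val + 1 = 2 then (1 : L) else 0) (IsCMField.complexConj_ne_one L) w hw γH.1 : ↥(unitaryGroupOfForm (galAdicCompletionMap (L := L) (IsCMField.complexConj L) hw) (placeForm (Matrix.of fun i j : Fin 2 =>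 if i.val + j.val + 1 = 2 then (1 : L) else 0) w.1))) : GL (Fin 2) (w.1.adicCompletion L)), ((localNonsplitEquiv (IsCMField.complexConj L) (Matrix.of fun i j : Fin 1 => if i.val + j.val + 1 = 1 then (1 : L) else 0) (IsCMField.complexConj_ne_one L) w hw γH.2).val : GL (Fin 1) (w.1.adicCompletion L)))) M₃ = M₃}.Finite →
              (∀ M₃ : Submodule (Valued.integer (w.1.adicCompletion L)) (Fin 3 → (w.1.adicCompletion L)), IsVertexLattice (galAdicCompletionMap (L := L) (IsCMField.complexConj L) hw) ϖ ((StdForm.antidiagonal 3).over (w.1.adicCompletion L)) 0 M₃ → mapGL (endoGL (((localNonsplitEquiv (IsCMField.complexConj L) (Matrix.of fun i j : Fin 2 => if i.val + j.val + 1 = 2 then (1 : L) else 0) (IsCMField.complexConj_ne_one L) w hw γH.1 : ↥(unitaryGroupOfForm (galAdicCompletionMap (L := L) (IsCMField.complexConj L) hw) (placeForm (Matrix.of fun i j : Fin 2 => if i.val + j.val + 1 = 2 then (1 : L) else 0) w.1))) : GL (Fin 2) (w.1.adicCompletion L)), ((localNonsplitEquiv (IsCMField.complexConj L) (Matrix.of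 fun i j : Fin 1 => if i.val + j.val + 1 = 1 then (1 : L) else 0) (IsCMField.complexConj_ne_one L) w hw γH.2).val : GL (Fin 1) (w.1.adicCompletion L)))) M₃ = M₃ →
                ∀ b : ℕ, (∀ c : (w.1.adicCompletion L), (Pi.single 1 c : Fin 3 → (w.1.adicCompletion L)) ∈ M₃ ↔ Valued.v c ≤ Valued.v ϖ ^ b) → b ≤ R) →
              {M₃ : Submodule (Valued.integer (w.1.adicCompletion L)) (Fin 3 → (w.1.adicCompletion L)) | IsSelfDualLattice (galAdicCompletionMap (L := L) (IsCMField.complexConj L) hw) ϖ (!![(Matrix.diagonal dg) 0 0, 0, (Matrix.diagonal dg) 0 1; 0, η, 0; (Matrix.diagonal dg) 1 0, 0, (Matrix.diagonal dg) 1 1] : Matrix (Fin 3) (Fin 3) (w.1.adicCompletion L)) M₃ ∧ mapGL (endoGL (γ₁, ((localNonsplitEquiv (IsCMField.complexConj L) (Matrix.of fun i j : Fin 1 => if i.val + j.val + 1 = 1 then (1 : L) else 0) (IsCMField.complexConj_ne_one L) w hw γH.2).val : GL (Fin 1) (w.1.adicCompletion L)))) M₃ = M₃}.Finite →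
              (∀ M₃ : Submodule (Valued.integer (w.1.adicCompletion L)) (Fin 3 → (w.1.adicCompletion L)), IsSelfDualLattice (galAdicCompletionMap (L := L) (IsCMField.complexConj L) hw) ϖ (!![(Matrix.diagonal dg) 0 0, 0, (Matrix.diagonal dg) 0 1; 0, η, 0; (Matrix.diagonal dg) 1 0, 0, (Matrix.diagonal dg) 1 1] : Matrix (Fin 3) (Fin 3) (w.1.adicCompletion L)) M₃ → mapGL (endoGL (γ₁, ((localNonsplitEquiv (IsCMField.complexConj L) (Matrix.of fun i j : Fin 1 => if i.val + j.val + 1 = 1 then (1 : L) else 0) (IsCMField.complexConj_ne_one L) w hw γH.2).val : GL (Fin 1) (w.1.adicCompletion L)))) M₃ = M₃ →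
                ∀ b : ℕ, (∀ c : (w.1.adicCompletion L), (Pi.single 1 c : Fin 3 → (w.1.adicCompletion L)) ∈ M₃ ↔ Valued.v c ≤ Valued.v ϖ ^ b) → b ≤ R') →
              ¬ IsOrd (galAdicCompletionMap (L := E') c₁ hw₁) α (toPlace w.1 w₁ ϖ ^ (J + 1)) lam →
              (∀ j a, (levelSet (galAdicCompletionMap (L := E') c₁ hw₁) Θ α (toPlace w.1 w₁ ϖ) h j a).Finite) →
              (∀ j a, (levelSet (galAdicCompletionMap (L := E') c₁ hw₁) Θ α (toPlace w.1 w₁ ϖ) h' j a).Finite) →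
              Valued.v ((((localNonsplitEquiv (IsCMField.complexConj L) (Matrix.of fun i j : Fin 1 => if i.val + j.val + 1 = 1 then (1 : L) else 0) (IsCMField.complexConj_ne_one L) w hw γH.2).val : GL (Fin 1) (w.1.adicCompletion L)) : Matrix (Fin 1) (Fin 1) (w.1.adicCompletion L)) 0 0) = 1 →
              (∀ (b j : ℕ) (Λ : AddSubgroup (w₁.1.adicCompletion E')) (x₀ : (w₁.1.adicCompletion E')) (r : (w.1.adicCompletion L)), 1 ≤ b → x₀ ≠ 0 →
                (∀ x, x ∈ Λ ↔ ∃ z, IsOrd (galAdicCompletionMap (L := E') c₁ hw₁) α (toPlace w.1 w₁ ϖ ^ j) z ∧ x = x₀ * z) →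
                IsOrd (galAdicCompletionMap (L := E') c₁ hw₁) α (toPlace w.1 w₁ ϖ ^ j) (dualGen (galAdicCompletionMap (L := E') c₁ hw₁) Θ α (toPlace w.1 w₁ ϖ ^ j) h x₀) → ¬ IsOrd (galAdicCompletionMap (L := E') c₁ hw₁) α (toPlace w.1 w₁ ϖ ^ j) (dualGen (galAdicCompletionMap (L := E') c₁ hw₁) Θ α (toPlace w.1 w₁ ϖ ^ j) h x₀ / toPlace w.1 w₁ ϖ) →
                Valued.v (dualGen (galAdicCompletionMap (L := E') c₁ hw₁) Θ α (toPlace w.1 w₁ ϖ ^ j) h x₀) = Valued.v (toPlace w.1 w₁ ϖ) ^ b →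
                (∀ b', (∀ x ∈ Λ, Valued.v (h * Θ x * b' + galAdicCompletionMap (L := E') c₁ hw₁ (h * Θ x * b')) ≤ 1) → (lam - toPlace w.1 w₁ ((((localNonsplitEquiv (IsCMField.complexConj L) (Matrix.of fun i j : Fin 1 => if i.val + j.val + 1 = 1 then (1 : L) else 0) (IsCMField.complexConj_ne_one L) w hw γH.2).val : GL (Fin 1) (w.1.adicCompletion L)) : Matrix (Fin 1) (Fin 1) (w.1.adicCompletion L)) 0 0)) * b' ∈ Λ) →
                IsOrd (galAdicCompletionMap (L := E') c₁ hw₁) α (toPlace w.1 w₁ ϖ ^ j) lam → toPlace w.1 w₁ r = glueUnit (galAdicCompletionMap (L := E') c₁ hw₁) Θ α (toPlace w.1 w₁ ϖ ^ j) h (toPlace w.1 w₁ ϖ) (toPlace w.1 w₁ 1) x₀ b →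
                f b j Λ = Nat.card {x : 𝒪[(w.1.adicCompletion L)] ⧸ 𝓂[(w.1.adicCompletion L)] ^ (2 * b) // ∃ u' : 𝒪[(w.1.adicCompletion L)], Ideal.Quotient.mk (𝓂[(w.1.adicCompletion L)] ^ (2 * b)) u' = x ∧
                  Valued.v ((u' : (w.1.adicCompletion L)) * (galAdicCompletionMap (L := L) (IsCMField.complexConj L) hw) u' - r) ≤ Valued.v (ϖ ^ (2 * b))}) →
              (∀ (b j : ℕ) (Λ : AddSubgroup (w₁.1.adicCompletion E')) (x₀ : (w₁.1.adicCompletion E')) (r : (w.1.adicCompletion L)), 1 ≤ b → x₀ ≠ 0 →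
                (∀ x, x ∈ Λ ↔ ∃ z, IsOrd (galAdicCompletionMap (L := E') c₁ hw₁) α (toPlace w.1 w₁ ϖ ^ j) z ∧ x = x₀ * z) →
                IsOrd (galAdicCompletionMap (L := E') c₁ hw₁) α (toPlace w.1 w₁ ϖ ^ j) (dualGen (galAdicCompletionMap (L := E') c₁ hw₁) Θ α (toPlace w.1 w₁ ϖ ^ j) h' x₀) → ¬ IsOrd (galAdicCompletionMap (L := E') c₁ hw₁) α (toPlace w.1 w₁ ϖ ^ j) (dualGen (galAdicCompletionMap (L := E') c₁ hw₁) Θ α (toPlace w.1 w₁ ϖ ^ j) h' x₀ / toPlace w.1 w₁ ϖ) →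
                Valued.v (dualGen (galAdicCompletionMap (L := E') c₁ hw₁) Θ α (toPlace w.1 w₁ ϖ ^ j) h' x₀) = Valued.v (toPlace w.1 w₁ ϖ) ^ b →
                (∀ b', (∀ x ∈ Λ, Valued.v (h' * Θ x * b' + galAdicCompletionMap (L := E') c₁ hw₁ (h' * Θ x * b')) ≤ 1) → (lam - toPlace w.1 w₁ ((((localNonsplitEquiv (IsCMField.complexConj L) (Matrix.of fun i j : Fin 1 => if i.val + j.val + 1 = 1 then (1 : L) else 0) (IsCMField.complexConj_ne_one L) w hw γH.2).val : GL (Fin 1) (w.1.adicCompletion L)) : Matrix (Fin 1) (Fin 1) (w.1.adicCompletion L)) 0 0)) * b' ∈ Λ) →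
                IsOrd (galAdicCompletionMap (L := E') c₁ hw₁) α (toPlace w.1 w₁ ϖ ^ j) lam → toPlace w.1 w₁ r = glueUnit (galAdicCompletionMap (L := E') c₁ hw₁) Θ α (toPlace w.1 w₁ ϖ ^ j) h' (toPlace w.1 w₁ ϖ) (toPlace w.1 w₁ η) x₀ b →
                f' b j Λ = Nat.card {x : 𝒪[(w.1.adicCompletion L)] ⧸ 𝓂[(w.1.adicCompletion L)] ^ (2 * b) // ∃ u' : 𝒪[(w.1.adicCompletion L)], Ideal.Quotient.mk (𝓂[(w.1.adicCompletion L)] ^ (2 * b)) u' = x ∧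
                  Valued.v ((u' : (w.1.adicCompletion L)) * (galAdicCompletionMap (L := L) (IsCMField.complexConj L) hw) u' - r) ≤ Valued.v (ϖ ^ (2 * b))}) →
            (∀ f₀ : (w₁.1.adicCompletion E'), galAdicCompletionMap (L := E') c₁ hw₁ f₀ = f₀ → Θ f₀ = f₀ → Valued.v f₀ = 1 → ∃ z : (w₁.1.adicCompletion E'), z * Θ z = f₀) ∧
            (∀ (m : ℕ) (β : (v.adicCompletion ↥(maximalRealSubfield L))ˣ), Valued.v (((finCharpolyTwo L v γH).eval (finGammaTwo L v γH)) w) = Valued.v ((toPlace v w (HeckeCharacter.uniformizer ↥(maximalRealSubfield L) v : v.adicCompletion ↥(maximalRealSubfield L))) ^ m) →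
              toPlace v w (β : (v.adicCompletion ↥(maximalRealSubfield L))) = -(((finCharpolyTwo L v γH).eval (finGammaTwo L v γH)) w * (finGammaTwo L v γH w ^ 2 + ((γH.1.val.val : Matrix (Fin 2) (Fin 2) (UnitaryGroup.LocalRing L v)).map (Pi.evalRingHom (fun w' : UnitaryGroup.PlacesOver L v => w'.1.adicCompletion L) w)).det)) / (2 * finGammaTwo L v γH w ^ 2 * ((γH.1.val.val : Matrix (Fin 2) (Fin 2) (UnitaryGroup.LocalRing L v)).map (Pi.evalRingHom (fun w' : UnitaryGroup.PlacesOver L v => w'.1.adicCompletion L) w)).det) →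
              (((Fintype.card (Valued.ResidueField (w.1.adicCompletion L))) : ℤ) - 1) * ((((∑ j ∈ Finset.range (J + 1), (if IsOrd (galAdicCompletionMap (L := E') c₁ hw₁) α (toPlace w.1 w₁ ϖ ^ j) lam then (levelSet (galAdicCompletionMap (L := E') c₁ hw₁) Θ α (toPlace w.1 w₁ ϖ) h j 0).ncard else 0)) + ∑ b ∈ Finset.Icc 1 R, ∑ j ∈ Finset.range (J + 1), (if IsOrd (galAdicCompletionMap (L := E') c₁ hw₁) α (toPlace w.1 w₁ ϖ ^ j) lam then Nat.card 𝓀[(w.1.adicCompletion L)] ^ b * (levelSetDep (galAdicCompletionMap (L := E') c₁ hw₁) Θ α (toPlace w.1 w₁ ϖ) h j b (lam - toPlace w.1 w₁ ((((localNonsplitEquiv (IsCMField.complexConj L) (Matrix.of fun i j : Fin 1 => if i.val + j.val + 1 = 1 then (1 : L) else 0) (IsCMField.complexConj_ne_one L) w hw γH.2).val : GL (Fin 1) (w.1.adicCompletion L)) : Matrix (Fin 1) (Fin 1) (w.1.adicCompletion L)) 0 0))).ncard else 0) : ℕ) : ℤ) - (((∑ j ∈ Finset.range (J + 1), (if IsOrd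 (galAdicCompletionMap (L := E') c₁ hw₁) α (toPlace w.1 w₁ ϖ ^ j) lam then (levelSet (galAdicCompletionMap (L := E') c₁ hw₁) Θ α (toPlace w.1 w₁ ϖ) h' j 0).ncard else 0)) + ∑ b ∈ Finset.Icc 1 R', ∑ j ∈ Finset.range (J + 1), (if IsOrd (galAdicCompletionMap (L := E') c₁ hw₁) α (toPlace w.1 w₁ ϖ ^ j) lam then Nat.card 𝓀[(w.1.adicCompletion L)] ^ b * (levelSetDep (galAdicCompletionMap (L := E') c₁ hw₁) Θ α (toPlace w.1 w₁ ϖ) h' j b (lam - toPlace w.1 w₁ ((((localNonsplitEquiv (IsCMField.complexConj L) (Matrix.of fun i j : Fin 1 => if i.val + j.val + 1 = 1 then (1 : L) else 0) (IsCMField.complexConj_ne_one L) w hw γH.2).val : GL (Fin 1) (w.1.adicCompletion L)) : Matrix (Fin 1) (Fin 1) (w.1.adicCompletion L)) 0 0))).ncard else 0) : ℕ) : ℤ)) = (Literature.NumberTheory.QuadraticForms.hilbertSymbol (v.adicCompletion ↥(maximalRealSubfield L)) (β : (v.adicCompletion ↥(maximalRealSubfield L))) (algebraMap ↥(maximalRealSubfield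 L) _ ((cmQuadraticGenerator L : 𝓞 ↥(maximalRealSubfield L)) : ↥(maximalRealSubfield L))) : ℤ) * ((Fintype.card (Valued.ResidueField (w.1.adicCompletion L))) : ℤ) ^ m * ((((Fintype.card (Valued.ResidueField (w.1.adicCompletion L))) : ℤ) - 1) * (((Nat.card (MulAction.fixedBy (((UnitaryGroup.cmDatum L 2 (Matrix.of fun i j : Fin 2 => if i.val + j.val + 1 = 2 then (1 : L) else 0)).Local v) ⧸ cmLocalIntegralLevel L 2 (Matrix.of fun i j : Fin 2 => if i.val + j.val + 1 = 2 then (1 : L) else 0) v) γH.1)) + d % 2 : ℕ) : ℤ) - 2 * (((Fintype.card (Valued.ResidueField (w.1.adicCompletion L))) : ℤ) ^ (d - d % 2) - 1)))) :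
    ∃ V ∈ 𝓝 (1 : ((UnitaryGroup.cmDatum L 2 (Matrix.of fun i j : Fin 2 => if i.val + j.val + 1 = 2 then (1 : L) else 0)).Local v × (UnitaryGroup.cmDatum L 1 (Matrix.of fun i j : Fin 1 => if i.val + j.val + 1 = 1 then (1 : L) else 0)).Local v)), ∀ γH ∈ V, IsLocalGRegular L v γH →
      ¬ (∃ x : (w.1.adicCompletion L), (((((γH).1.val : GL (Fin 2) (UnitaryGroup.LocalRing L v)).val.map (Pi.evalRingHom (fun w' : UnitaryGroup.PlacesOver L v => w'.1.adicCompletion L) w))).charpoly).IsRoot x) →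
      ∀ (E' : Type) [Field E'] [NumberField E'] [Algebra L E'] [Algebra.IsQuadraticExtension L E'] (c₁ : E' ≃ₐ[L] E') (δ : E') (m₀ : L)
        (s : (w.1.adicCompletion L)) (w₁ : UnitaryGroup.PlacesOver E' w.1) (hw₁ : c₁ • w₁.1 = w₁.1)
        (Θ : (w₁.1.adicCompletion E') →+* (w₁.1.adicCompletion E')) (α lam : (w₁.1.adicCompletion E')),
        c₁ ≠ 1 → c₁ δ = -δ → δ ≠ 0 → algebraMap L E' m₀ = δ ^ 2 → s ≠ 0 →
        (((γH.1.val : GL (Fin 2) (UnitaryGroup.LocalRing L v)).val.map (Pi.evalRingHom (fun w' : UnitaryGroup.PlacesOver L v => w'.1.adicCompletion L) w))).trace * (((γH.1.val : GL (Fin 2) (UnitaryGroup.LocalRing L v)).val.map (Pi.evalRingHom (fun w' : UnitaryGroup.PlacesOver L v => w'.1.adicCompletion L) w))).trace - 4 * (((γH.1.val : GL (Fin 2) (UnitaryGroup.LocalRing L v)).val.map (Pi.evalRingHom (fun w' : UnitaryGroup.PlacesOver L v => w'.1.adicCompletion L) w))).det = s * s * ((m₀ : L) : (w.1.adicCompletion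 L)) →
        (((γH.1.val : GL (Fin 2) (UnitaryGroup.LocalRing L v)).val.map (Pi.evalRingHom (fun w' : UnitaryGroup.PlacesOver L v => w'.1.adicCompletion L) w))).det * (galAdicCompletionMap (L := L) (IsCMField.complexConj L) hw) (((γH.1.val : GL (Fin 2) (UnitaryGroup.LocalRing L v)).val.map (Pi.evalRingHom (fun w' : UnitaryGroup.PlacesOver L v => w'.1.adicCompletion L) w))).det = 1 → (((γH.1.val : GL (Fin 2) (UnitaryGroup.LocalRing L v)).val.map (Pi.evalRingHom (fun w' : UnitaryGroup.PlacesOver L v => w'.1.adicCompletion L) w))).trace = (((γH.1.val : GL (Fin 2) (UnitaryGroup.LocalRing L v)).val.map (Pi.evalRingHom (fun w' : UnitaryGroup.PlacesOver L v => w'.1.adicCompletion L) w))).det * (galAdicCompletionMap (L := L) (IsCMField.complexConj L) hw) (((γH.1.val : GL (Fin 2) (UnitaryGroup.LocalRing L v)).val.map (Pi.evalRingHom (fun w' : UnitaryGroup.PlacesOver L v => w'.1.adicCompletion L) w))).trace →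
        (∀ x : (w.1.adicCompletion L), x * x - (((γH.1.val : GL (Fin 2) (UnitaryGroup.LocalRing L v)).val.map (Pi.evalRingHom (fun w' : UnitaryGroup.PlacesOver L v => w'.1.adicCompletion L) w))).trace * x + (((γH.1.val : GL (Fin 2) (UnitaryGroup.LocalRing L v)).val.map (Pi.evalRingHom (fun w' : UnitaryGroup.PlacesOver L v => w'.1.adicCompletion L) w))).det ≠ 0) →
        (∀ z, galAdicCompletionMap (L := E') c₁ hw₁ (galAdicCompletionMap (L := E') c₁ hw₁ z) = z) →
        (∀ z, Valued.v (galAdicCompletionMap (L := E') c₁ hw₁ z) = Valued.v z) →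
        (∀ a, galAdicCompletionMap (L := E') c₁ hw₁ (toPlace w.1 w₁ a) = toPlace w.1 w₁ a) →
        (∀ a, Valued.v (toPlace w.1 w₁ a) ≤ 1 ↔ Valued.v a ≤ 1) →
        (∀ z : (w₁.1.adicCompletion E'), galAdicCompletionMap (L := E') c₁ hw₁ z = z ↔ ∃ a, toPlace w.1 w₁ a = z) →
        (∀ a, Θ (toPlace w.1 w₁ a) = toPlace w.1 w₁ ((galAdicCompletionMap (L := L) (IsCMField.complexConj L) hw) a)) →
        (∀ z, Θ (Θ z) = z) →
        (∀ z, Θ (galAdicCompletionMap (L := E') c₁ hw₁ z) = galAdicCompletionMap (L := E') c₁ hw₁ (Θ z)) →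
        (∀ z, Valued.v (Θ z) = Valued.v z) →
        galAdicCompletionMap (L := E') c₁ hw₁ α ≠ α →
        Valued.v α ≤ 1 →
        (∀ z : (w₁.1.adicCompletion E'), Valued.v z ≤ 1 → Valued.v ((z - galAdicCompletionMap (L := E') c₁ hw₁ z) / (α - galAdicCompletionMap (L := E') c₁ hw₁ α)) ≤ 1) →
        2 * lam = toPlace w.1 w₁ (((γH.1.val : GL (Fin 2) (UnitaryGroup.LocalRing L v)).val.map (Pi.evalRingHom (fun w' : UnitaryGroup.PlacesOver L v => w'.1.adicCompletion L) w))).trace + toPlace w.1 w₁ s * ((δ : E') : (w₁.1.adicCompletion E')) →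
        lam * lam = toPlace w.1 w₁ (((γH.1.val : GL (Fin 2) (UnitaryGroup.LocalRing L v)).val.map (Pi.evalRingHom (fun w' : UnitaryGroup.PlacesOver L v => w'.1.adicCompletion L) w))).trace * lam - toPlace w.1 w₁ (((γH.1.val : GL (Fin 2) (UnitaryGroup.LocalRing L v)).val.map (Pi.evalRingHom (fun w' : UnitaryGroup.PlacesOver L v => w'.1.adicCompletion L) w))).det →
        galAdicCompletionMap (L := E') c₁ hw₁ lam = toPlace w.1 w₁ (((γH.1.val : GL (Fin 2) (UnitaryGroup.LocalRing L v)).val.map (Pi.evalRingHom (fun w' : UnitaryGroup.PlacesOver L v => w'.1.adicCompletion L) w))).trace - lam →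
        Θ lam * lam = 1 →
        Valued.v lam = 1 →
        (∀ z : (w₁.1.adicCompletion E'), ∃! pq : (w.1.adicCompletion L) × (w.1.adicCompletion L), z = toPlace w.1 w₁ pq.1 + toPlace w.1 w₁ pq.2 * lam) →
        ∀ (th ta : ((UnitaryGroup.cmDatum L 3 (Matrix.of fun i j : Fin 3 => if i.val + j.val + 1 = 3 then (1 : L) else 0)).Local v)) (P₁ : GL (Fin 3) (w.1.adicCompletion L)) (dg : Fin 2 → (w.1.adicCompletion L)) (η : (w.1.adicCompletion L)) (γ₁ : GL (Fin 2) (w.1.adicCompletion L)),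
          ((localNonsplitEquiv (IsCMField.complexConj L) (Matrix.of fun i j : Fin 3 => if i.val + j.val + 1 = 3 then (1 : L) else 0) (IsCMField.complexConj_ne_one L) w hw th : ↥(unitaryGroupOfForm (galAdicCompletionMap (L := L) (IsCMField.complexConj L) hw) (placeForm (Matrix.of fun i j : Fin 3 => if i.val + j.val + 1 = 3 then (1 : L) else 0) w.1))) : GL (Fin 3) (w.1.adicCompletion L)) = endoGL (((localNonsplitEquiv (IsCMField.complexConj L) (Matrix.of fun i j : Fin 2 => if i.val + j.val + 1 = 2 then (1 : L) else 0) (IsCMField.complexConj_ne_one L) w hw γH.1 : ↥(unitaryGroupOfForm (galAdicCompletionMap (L := L) (IsCMField.complexConj L) hw) (placeForm (Matrix.of fun i j : Fin 2 => if i.val + j.val + 1 = 2 then (1 : L) else 0) w.1))) : GL (Fin 2) (w.1.adicCompletion L)), ((localNonsplitEquiv (IsCMField.complexConj L) (Matrix.of fun i j : Fin 1 => if i.val + j.val + 1 = 1 then (1 : L) else 0) (IsCMField.complexConj_ne_one L) w hw γH.2).val : GL (Fin 1) (w.1.adicCompletion L))) →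
          ((localNonsplitEquiv (IsCMField.complexConj L) (Matrix.of fun i j : Fin 3 => if i.val + j.val + 1 = 3 then (1 : L) else 0) (IsCMField.complexConj_ne_one L) w hw ta : ↥(unitaryGroupOfForm (galAdicCompletionMap (L := L) (IsCMField.complexConj L) hw) (placeForm (Matrix.of fun i j : Fin 3 => if i.val + j.val + 1 = 3 then (1 : L) else 0) w.1))) : GL (Fin 3) (w.1.adicCompletion L)) = P₁ * endoGL (γ₁, ((localNonsplitEquiv (IsCMField.complexConj L) (Matrix.of fun i j : Fin 1 => if i.val + j.val + 1 = 1 then (1 : L) else 0) (IsCMField.complexConj_ne_one L) w hw γH.2).val : GL (Fin 1) (w.1.adicCompletion L))) * P₁⁻¹ →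
          formCongr (galAdicCompletionMap (L := L) (IsCMField.complexConj L) hw) P₁ (placeForm (Matrix.of fun i j : Fin 3 => if i.val + j.val + 1 = 3 then (1 : L) else 0) w.1) = (!![(Matrix.diagonal dg) 0 0, 0, (Matrix.diagonal dg) 0 1; 0, η, 0; (Matrix.diagonal dg) 1 0, 0, (Matrix.diagonal dg) 1 1] : Matrix (Fin 3) (Fin 3) (w.1.adicCompletion L)) →
          (∀ i, Valued.v (dg i) = 1) →
          (∀ i, (galAdicCompletionMap (L := L) (IsCMField.complexConj L) hw) (dg i) = dg i) →
          (galAdicCompletionMap (L := L) (IsCMField.complexConj L) hw) η = η →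
          Valued.v η = 1 →
          (¬ ∃ t : (w.1.adicCompletion L), t * (galAdicCompletionMap (L := L) (IsCMField.complexConj L) hw) t = η) →
          γ₁ ∈ unitaryGroupOfForm (galAdicCompletionMap (L := L) (IsCMField.complexConj L) hw) (Matrix.diagonal dg) →
          (γ₁ : Matrix (Fin 2) (Fin 2) (w.1.adicCompletion L)).charpoly = (((γH.1.val : GL (Fin 2) (UnitaryGroup.LocalRing L v)).val.map (Pi.evalRingHom (fun w' : UnitaryGroup.PlacesOver L v => w'.1.adicCompletion L) w))).charpoly →
        ∀ (φ : (Fin 2 → (w.1.adicCompletion L)) →+ (w₁.1.adicCompletion E')) (h : (w₁.1.adicCompletion E')) (φ' : (Fin 2 → (w.1.adicCompletion L)) →+ (w₁.1.adicCompletion E')) (h' : (w₁.1.adicCompletion E')),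
          (∀ (c : (w.1.adicCompletion L)) (x : Fin 2 → (w.1.adicCompletion L)), φ (c • x) = toPlace w.1 w₁ c * φ x) →
          Function.Injective φ →
          Function.Surjective φ →
          (∀ x, φ ((((localNonsplitEquiv (IsCMField.complexConj L) (Matrix.of fun i j : Fin 2 => if i.val + j.val + 1 = 2 then (1 : L) else 0) (IsCMField.complexConj_ne_one L) w hw γH.1 : ↥(unitaryGroupOfForm (galAdicCompletionMap (L := L) (IsCMField.complexConj L) hw) (placeForm (Matrix.of fun i j : Fin 2 => if i.val + j.val + 1 = 2 then (1 : L) else 0) w.1))) : GL (Fin 2) (w.1.adicCompletion L)) : Matrix (Fin 2) (Fin 2) (w.1.adicCompletion L)).mulVec x) = lam * φ x) →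
          (∀ x y, toPlace w.1 w₁ (pairing (galAdicCompletionMap (L := L) (IsCMField.complexConj L) hw) (placeForm (Matrix.of fun i j : Fin 2 => if i.val + j.val + 1 = 2 then (1 : L) else 0) w.1) x y) = h * Θ (φ x) * φ y + galAdicCompletionMap (L := E') c₁ hw₁ (h * Θ (φ x) * φ y)) →
          Θ h = h →
          h ≠ 0 →
          (∃ x : (w₁.1.adicCompletion E'), x ≠ 0 ∧ h * Θ x * x + galAdicCompletionMap (L := E') c₁ hw₁ (h * Θ x * x) = 0) →
          (∀ (c : (w.1.adicCompletion L)) (x : Fin 2 → (w.1.adicCompletion L)), φ' (c • x) = toPlace w.1 w₁ c * φ' x) →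
          Function.Injective φ' →
          Function.Surjective φ' →
          (∀ x, φ' ((γ₁ : Matrix (Fin 2) (Fin 2) (w.1.adicCompletion L)).mulVec x) = lam * φ' x) →
          (∀ x y, toPlace w.1 w₁ (pairing (galAdicCompletionMap (L := L) (IsCMField.complexConj L) hw) (Matrix.diagonal dg) x y) = h' * Θ (φ' x) * φ' y + galAdicCompletionMap (L := E') c₁ hw₁ (h' * Θ (φ' x) * φ' y)) →
          Θ h' = h' →
          h' ≠ 0 →
          (∀ (t : (w.1.adicCompletion L)) (n : ℤ), Valued.v (toPlace w.1 w₁ t) = Valued.v (toPlace w.1 w₁ ϖ) ^ n ↔ Valued.v t = Valued.v ϖ ^ n) →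
          (∀ c : (w₁.1.adicCompletion E'), galAdicCompletionMap (L := E') c₁ hw₁ c = c → c ≠ 0 → Valued.v c ≤ 1 → ∃ n : ℕ, Valued.v c = Valued.v (toPlace w.1 w₁ ϖ) ^ n) →
          (∀ t : (w₁.1.adicCompletion E'), galAdicCompletionMap (L := E') c₁ hw₁ t = t → Valued.v t < 1 → Valued.v t ≤ Valued.v (toPlace w.1 w₁ ϖ)) →
            ∀ (J R R' : ℕ) (f f' : ℕ → ℕ → AddSubgroup (w₁.1.adicCompletion E') → ℕ),
            {M₃ : Submodule (Valued.integer (w.1.adicCompletion L)) (Fin 3 → (w.1.adicCompletion L)) | IsVertexLattice (galAdicCompletionMap (L := L) (IsCMField.complexConj L) hw) ϖ ((StdForm.antidiagonal 3).over (w.1.adicCompletion L)) 0 M₃ ∧ mapGL (endoGL (((localNonsplitEquiv (IsCMField.complexConj L) (Matrix.of fun i j : Fin 2 => if i.val + j.val + 1 = 2 then (1 : L) else 0) (IsCMField.complexConj_ne_one L) w hw γH.1 : ↥(unitaryGroupOfForm (galAdicCompletionMap (L := L) (IsCMField.complexConj L) hw) (placeForm (Matrix.of fun i j : Fin 2 =>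 if i.val + j.val + 1 = 2 then (1 : L) else 0) w.1))) : GL (Fin 2) (w.1.adicCompletion L)), ((localNonsplitEquiv (IsCMField.complexConj L) (Matrix.of fun i j : Fin 1 => if i.val + j.val + 1 = 1 then (1 : L) else 0) (IsCMField.complexConj_ne_one L) w hw γH.2).val : GL (Fin 1) (w.1.adicCompletion L)))) M₃ = M₃}.Finite →
            (∀ M₃ : Submodule (Valued.integer (w.1.adicCompletion L)) (Fin 3 → (w.1.adicCompletion L)), IsVertexLattice (galAdicCompletionMap (L := L) (IsCMField.complexConj L) hw) ϖ ((StdForm.antidiagonal 3).over (w.1.adicCompletion L)) 0 M₃ → mapGL (endoGL (((localNonsplitEquiv (IsCMField.complexConj L) (Matrix.of fun i j : Fin 2 => if i.val + j.val + 1 = 2 then (1 : L) else 0) (IsCMField.complexConj_ne_one L) w hw γH.1 : ↥(unitaryGroupOfForm (galAdicCompletionMap (L := L) (IsCMField.complexConj L) hw) (placeForm (Matrix.of fun i j : Fin 2 => if i.val + j.val + 1 = 2 then (1 : L) else 0) w.1))) : GL (Fin 2) (w.1.adicCompletion L)), ((localNonsplitEquiv (IsCMField.complexConj L) (Matrix.of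 fun i j : Fin 1 => if i.val + j.val + 1 = 1 then (1 : L) else 0) (IsCMField.complexConj_ne_one L) w hw γH.2).val : GL (Fin 1) (w.1.adicCompletion L)))) M₃ = M₃ →
              ∀ b : ℕ, (∀ c : (w.1.adicCompletion L), (Pi.single 1 c : Fin 3 → (w.1.adicCompletion L)) ∈ M₃ ↔ Valued.v c ≤ Valued.v ϖ ^ b) → b ≤ R) →
            {M₃ : Submodule (Valued.integer (w.1.adicCompletion L)) (Fin 3 → (w.1.adicCompletion L)) | IsSelfDualLattice (galAdicCompletionMap (L := L) (IsCMField.complexConj L) hw) ϖ (!![(Matrix.diagonal dg) 0 0, 0, (Matrix.diagonal dg) 0 1; 0, η, 0; (Matrix.diagonal dg) 1 0, 0, (Matrix.diagonal dg) 1 1] : Matrix (Fin 3) (Fin 3) (w.1.adicCompletion L)) M₃ ∧ mapGL (endoGL (γ₁, ((localNonsplitEquiv (IsCMField.complexConj L) (Matrix.of fun i j : Fin 1 => if i.val + j.val + 1 = 1 then (1 : L) else 0) (IsCMField.complexConj_ne_one L) w hw γH.2).val : GL (Fin 1) (w.1.adicCompletion L)))) M₃ = M₃}.Finite →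
            (∀ M₃ : Submodule (Valued.integer (w.1.adicCompletion L)) (Fin 3 → (w.1.adicCompletion L)), IsSelfDualLattice (galAdicCompletionMap (L := L) (IsCMField.complexConj L) hw) ϖ (!![(Matrix.diagonal dg) 0 0, 0, (Matrix.diagonal dg) 0 1; 0, η, 0; (Matrix.diagonal dg) 1 0, 0, (Matrix.diagonal dg) 1 1] : Matrix (Fin 3) (Fin 3) (w.1.adicCompletion L)) M₃ → mapGL (endoGL (γ₁, ((localNonsplitEquiv (IsCMField.complexConj L) (Matrix.of fun i j : Fin 1 => if i.val + j.val + 1 = 1 then (1 : L) else 0) (IsCMField.complexConj_ne_one L) w hw γH.2).val : GL (Fin 1) (w.1.adicCompletion L)))) M₃ = M₃ →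
              ∀ b : ℕ, (∀ c : (w.1.adicCompletion L), (Pi.single 1 c : Fin 3 → (w.1.adicCompletion L)) ∈ M₃ ↔ Valued.v c ≤ Valued.v ϖ ^ b) → b ≤ R') →
            ¬ IsOrd (galAdicCompletionMap (L := E') c₁ hw₁) α (toPlace w.1 w₁ ϖ ^ (J + 1)) lam →
            (∀ j a, (levelSet (galAdicCompletionMap (L := E') c₁ hw₁) Θ α (toPlace w.1 w₁ ϖ) h j a).Finite) →
            (∀ j a, (levelSet (galAdicCompletionMap (L := E') c₁ hw₁) Θ α (toPlace w.1 w₁ ϖ) h' j a).Finite) →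
            Valued.v ((((localNonsplitEquiv (IsCMField.complexConj L) (Matrix.of fun i j : Fin 1 => if i.val + j.val + 1 = 1 then (1 : L) else 0) (IsCMField.complexConj_ne_one L) w hw γH.2).val : GL (Fin 1) (w.1.adicCompletion L)) : Matrix (Fin 1) (Fin 1) (w.1.adicCompletion L)) 0 0) = 1 →
            (∀ (b j : ℕ) (Λ : AddSubgroup (w₁.1.adicCompletion E')) (x₀ : (w₁.1.adicCompletion E')) (r : (w.1.adicCompletion L)), 1 ≤ b → x₀ ≠ 0 →
              (∀ x, x ∈ Λ ↔ ∃ z, IsOrd (galAdicCompletionMap (L := E') c₁ hw₁) α (toPlace w.1 w₁ ϖ ^ j) z ∧ x = x₀ * z) →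
              IsOrd (galAdicCompletionMap (L := E') c₁ hw₁) α (toPlace w.1 w₁ ϖ ^ j) (dualGen (galAdicCompletionMap (L := E') c₁ hw₁) Θ α (toPlace w.1 w₁ ϖ ^ j) h x₀) → ¬ IsOrd (galAdicCompletionMap (L := E') c₁ hw₁) α (toPlace w.1 w₁ ϖ ^ j) (dualGen (galAdicCompletionMap (L := E') c₁ hw₁) Θ α (toPlace w.1 w₁ ϖ ^ j) h x₀ / toPlace w.1 w₁ ϖ) →
              Valued.v (dualGen (galAdicCompletionMap (L := E') c₁ hw₁) Θ α (toPlace w.1 w₁ ϖ ^ j) h x₀) = Valued.v (toPlace w.1 w₁ ϖ) ^ b →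
              (∀ b', (∀ x ∈ Λ, Valued.v (h * Θ x * b' + galAdicCompletionMap (L := E') c₁ hw₁ (h * Θ x * b')) ≤ 1) → (lam - toPlace w.1 w₁ ((((localNonsplitEquiv (IsCMField.complexConj L) (Matrix.of fun i j : Fin 1 => if i.val + j.val + 1 = 1 then (1 : L) else 0) (IsCMField.complexConj_ne_one L) w hw γH.2).val : GL (Fin 1) (w.1.adicCompletion L)) : Matrix (Fin 1) (Fin 1) (w.1.adicCompletion L)) 0 0)) * b' ∈ Λ) →
              IsOrd (galAdicCompletionMap (L := E') c₁ hw₁) α (toPlace w.1 w₁ ϖ ^ j) lam → toPlace w.1 w₁ r = glueUnit (galAdicCompletionMap (L := E') c₁ hw₁) Θ α (toPlace w.1 w₁ ϖ ^ j) h (toPlace w.1 w₁ ϖ) (toPlace w.1 w₁ 1) x₀ b →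
              f b j Λ = Nat.card {x : 𝒪[(w.1.adicCompletion L)] ⧸ 𝓂[(w.1.adicCompletion L)] ^ (2 * b) // ∃ u' : 𝒪[(w.1.adicCompletion L)], Ideal.Quotient.mk (𝓂[(w.1.adicCompletion L)] ^ (2 * b)) u' = x ∧
                Valued.v ((u' : (w.1.adicCompletion L)) * (galAdicCompletionMap (L := L) (IsCMField.complexConj L) hw) u' - r) ≤ Valued.v (ϖ ^ (2 * b))}) →
            (∀ (b j : ℕ) (Λ : AddSubgroup (w₁.1.adicCompletion E')) (x₀ : (w₁.1.adicCompletion E')) (r : (w.1.adicCompletion L)), 1 ≤ b → x₀ ≠ 0 →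
              (∀ x, x ∈ Λ ↔ ∃ z, IsOrd (galAdicCompletionMap (L := E') c₁ hw₁) α (toPlace w.1 w₁ ϖ ^ j) z ∧ x = x₀ * z) →
              IsOrd (galAdicCompletionMap (L := E') c₁ hw₁) α (toPlace w.1 w₁ ϖ ^ j) (dualGen (galAdicCompletionMap (L := E') c₁ hw₁) Θ α (toPlace w.1 w₁ ϖ ^ j) h' x₀) → ¬ IsOrd (galAdicCompletionMap (L := E') c₁ hw₁) α (toPlace w.1 w₁ ϖ ^ j) (dualGen (galAdicCompletionMap (L := E') c₁ hw₁) Θ α (toPlace w.1 w₁ ϖ ^ j) h' x₀ / toPlace w.1 w₁ ϖ) →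
              Valued.v (dualGen (galAdicCompletionMap (L := E') c₁ hw₁) Θ α (toPlace w.1 w₁ ϖ ^ j) h' x₀) = Valued.v (toPlace w.1 w₁ ϖ) ^ b →
              (∀ b', (∀ x ∈ Λ, Valued.v (h' * Θ x * b' + galAdicCompletionMap (L := E') c₁ hw₁ (h' * Θ x * b')) ≤ 1) → (lam - toPlace w.1 w₁ ((((localNonsplitEquiv (IsCMField.complexConj L) (Matrix.of fun i j : Fin 1 => if i.val + j.val + 1 = 1 then (1 : L) else 0) (IsCMField.complexConj_ne_one L) w hw γH.2).val : GL (Fin 1) (w.1.adicCompletion L)) : Matrix (Fin 1) (Fin 1) (w.1.adicCompletion L)) 0 0)) * b' ∈ Λ) →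
              IsOrd (galAdicCompletionMap (L := E') c₁ hw₁) α (toPlace w.1 w₁ ϖ ^ j) lam → toPlace w.1 w₁ r = glueUnit (galAdicCompletionMap (L := E') c₁ hw₁) Θ α (toPlace w.1 w₁ ϖ ^ j) h' (toPlace w.1 w₁ ϖ) (toPlace w.1 w₁ η) x₀ b →
              f' b j Λ = Nat.card {x : 𝒪[(w.1.adicCompletion L)] ⧸ 𝓂[(w.1.adicCompletion L)] ^ (2 * b) // ∃ u' : 𝒪[(w.1.adicCompletion L)], Ideal.Quotient.mk (𝓂[(w.1.adicCompletion L)] ^ (2 * b)) u' = x ∧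
                Valued.v ((u' : (w.1.adicCompletion L)) * (galAdicCompletionMap (L := L) (IsCMField.complexConj L) hw) u' - r) ≤ Valued.v (ϖ ^ (2 * b))}) →
          ∀ (m : ℕ) (β : (v.adicCompletion ↥(maximalRealSubfield L))ˣ), Valued.v (((finCharpolyTwo L v γH).eval (finGammaTwo L v γH)) w) = Valued.v ((toPlace v w (HeckeCharacter.uniformizer ↥(maximalRealSubfield L) v : v.adicCompletion ↥(maximalRealSubfield L))) ^ m) →
            toPlace v w (β : (v.adicCompletion ↥(maximalRealSubfield L))) = -(((finCharpolyTwo L v γH).eval (finGammaTwo L v γH)) w * (finGammaTwo L v γH w ^ 2 + ((γH.1.val.val : Matrix (Fin 2) (Fin 2) (UnitaryGroup.LocalRing L v)).map (Pi.evalRingHom (fun w' : UnitaryGroup.PlacesOver L v => w'.1.adicCompletion L) w)).det)) / (2 * finGammaTwo L v γH w ^ 2 * ((γH.1.val.val : Matrix (Fin 2) (Fin 2) (UnitaryGroup.LocalRing L v)).map (Pi.evalRingHom (fun w' : UnitaryGroup.PlacesOver L v => w'.1.adicCompletion L) w)).det) →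
            (((Fintype.card (Valued.ResidueField (w.1.adicCompletion L))) : ℤ) - 1) * ((((∑ j ∈ Finset.range (J + 1), (if IsOrd (galAdicCompletionMap (L := E') c₁ hw₁) α (toPlace w.1 w₁ ϖ ^ j) lam then (levelSet (galAdicCompletionMap (L := E') c₁ hw₁) Θ α (toPlace w.1 w₁ ϖ) h j 0).ncard else 0)) + ∑ b ∈ Finset.Icc 1 R, ∑ j ∈ Finset.range (J + 1), (if IsOrd (galAdicCompletionMap (L := E') c₁ hw₁) α (toPlace w.1 w₁ ϖ ^ j) lam then ∑ᶠ Λ ∈ levelSetDep (galAdicCompletionMap (L := E') c₁ hw₁) Θ α (toPlace w.1 w₁ ϖ) h j b (lam - toPlace w.1 w₁ ((((localNonsplitEquiv (IsCMField.complexConj L) (Matrix.of fun i j : Fin 1 => if i.val + j.val + 1 = 1 then (1 : L) else 0) (IsCMField.complexConj_ne_one L) w hw γH.2).val : GL (Fin 1) (w.1.adicCompletion L)) : Matrix (Fin 1) (Fin 1) (w.1.adicCompletion L)) 0 0)), f b j Λ else 0) : ℕ) : ℤ) - (((∑ j ∈ Finset.range (J + 1), (if IsOrd (galAdicCompletionMap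 (L := E') c₁ hw₁) α (toPlace w.1 w₁ ϖ ^ j) lam then (levelSet (galAdicCompletionMap (L := E') c₁ hw₁) Θ α (toPlace w.1 w₁ ϖ) h' j 0).ncard else 0)) + ∑ b ∈ Finset.Icc 1 R', ∑ j ∈ Finset.range (J + 1), (if IsOrd (galAdicCompletionMap (L := E') c₁ hw₁) α (toPlace w.1 w₁ ϖ ^ j) lam then ∑ᶠ Λ ∈ levelSetDep (galAdicCompletionMap (L := E') c₁ hw₁) Θ α (toPlace w.1 w₁ ϖ) h' j b (lam - toPlace w.1 w₁ ((((localNonsplitEquiv (IsCMField.complexConj L) (Matrix.of fun i j : Fin 1 => if i.val + j.val + 1 = 1 then (1 : L) else 0) (IsCMField.complexConj_ne_one L) w hw γH.2).val : GL (Fin 1) (w.1.adicCompletion L)) : Matrix (Fin 1) (Fin 1) (w.1.adicCompletion L)) 0 0)), f' b j Λ else 0) : ℕ) : ℤ)) = (Literature.NumberTheory.QuadraticForms.hilbertSymbol (v.adicCompletion ↥(maximalRealSubfield L)) (β : (v.adicCompletion ↥(maximalRealSubfield L))) (algebraMap ↥(maximalRealSubfield L) _ ((cmQuadraticGenerator L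 : 𝓞 ↥(maximalRealSubfield L)) : ↥(maximalRealSubfield L))) : ℤ) * ((Fintype.card (Valued.ResidueField (w.1.adicCompletion L))) : ℤ) ^ m * ((((Fintype.card (Valued.ResidueField (w.1.adicCompletion L))) : ℤ) - 1) * (((Nat.card (MulAction.fixedBy (((UnitaryGroup.cmDatum L 2 (Matrix.of fun i j : Fin 2 => if i.val + j.val + 1 = 2 then (1 : L) else 0)).Local v) ⧸ cmLocalIntegralLevel L 2 (Matrix.of fun i j : Fin 2 => if i.val + j.val + 1 = 2 then (1 : L) else 0) v) γH.1)) + d % 2 : ℕ) : ℤ) - 2 * (((Fintype.card (Valued.ResidueField (w.1.adicCompletion L))) : ℤ) ^ (d - d % 2) - 1)) := by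
  haveI : IsDiscreteValuationRing 𝒪[w.1.adicCompletion L] := inferInstanceAs (IsDiscreteValuationRing (w.1.adicCompletionIntegers L))
  haveI : Finite 𝓀[w.1.adicCompletion L] := Finite.of_fintype (Valued.ResidueField (w.1.adicCompletion L))
  have hσ : ∀ a, (galAdicCompletionMap (L := L) (IsCMField.complexConj L) hw) ((galAdicCompletionMap (L := L) (IsCMField.complexConj L) hw) a) = a := galAdicCompletionMap_involutive L v w hw
  have hvσ : ∀ a, Valued.v ((galAdicCompletionMap (L := L) (IsCMField.complexConj L) hw) a) = Valued.v a := fun a => valued_galAdicCompletionMap (L := L) (IsCMField.complexConj L) hw a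
  have hH₂σ : ((placeForm (Matrix.of fun i j : Fin 2 => if i.val + j.val + 1 = 2 then (1 : L) else 0) w.1).map (galAdicCompletionMap (L := L) (IsCMField.complexConj L) hw))ᵀ = placeForm (Matrix.of fun i j : Fin 2 => if i.val + j.val + 1 = 2 then (1 : L) else 0) w.1 :=
    placeForm_map_transpose_of_hermitian L v w hw _ (antidiagOne_isHermitian L 2)
  obtain ⟨V, hV, hC⟩ := hOC
  refine ⟨V, hV, ?_⟩
  intro γH hγ hreg htyp E' _ _ _ _ c₁ δ m₀ s w₁ hw₁ Θ α lam hc₁ hδ hδ0 hm₀ hs0 hdisc hDD htr hχ hρρ hvρ hρj hjv hjfix hΘj hΘΘ hΘρ hvΘ hα hα1 hint h2lam hlam2 hρlam hΘlam hlam huniq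
    th ta P₁ dg η γ₁ hth hta hfc hdg1 hdgσ hησ hη1 hηN hγ₁U hchar
    φ h φ' h' hφs hφi hφo hφγ hform hΘh hh hiso hφ's hφ'i hφ'o hφ'γ hform' hΘh' hh' hjpow hEval hϖmax
    J R R' f f' hfinF hR hfinF' hR' hJ hfinLS hfinLS' hu hf hf' m β hm hβ
  obtain ⟨hFN, hrest⟩ := hC γH hγ hreg htyp E' c₁ δ m₀ s w₁ hw₁ Θ α lam hc₁ hδ hδ0 hm₀ hs0 hdisc hDD htr hχ hρρ hvρ hρj hjv hjfix hΘj hΘΘ hΘρ hvΘ hα hα1 hint h2lam hlam2 hρlam hΘlam hlam huniq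
    th ta P₁ dg η γ₁ hth hta hfc hdg1 hdgσ hησ hη1 hηN hγ₁U hchar
    φ h φ' h' hφs hφi hφo hφγ hform hΘh hh hiso hφ's hφ'i hφ'o hφ'γ hform' hΘh' hh' hjpow hEval hϖmax
    J R R' f f' hfinF hR hfinF' hR' hJ hfinLS hfinLS' hu hf hf'
  have key := hrest m β hm hβ
  -- `diag dg` is hermitian (`σ_w dg = dg`)
  have hDgσ : ((Matrix.diagonal dg).map (galAdicCompletionMap (L := L) (IsCMField.complexConj L) hw))ᵀ = Matrix.diagonal dg := by
    rw [Matrix.diagonal_map (map_zero _), Matrix.diagonal_transpose]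
    exact congrArg Matrix.diagonal (funext hdgσ)
  -- the flip unit from the conjunct `hFN`
  obtain ⟨z, ξ, hz1, hzξ, hσξ, hξN⟩ := exists_flipUnit_of_forall_fixed_fixed_isNorm (galAdicCompletionMap (L := L) (IsCMField.complexConj L) hw) hD (toPlace w.1 w₁) hvΘ hΘj hjfix hjpow hFN
  have hconeP : ∀ b ∈ Finset.Icc 1 R, ∀ j ∈ Finset.range (J + 1),
      (if IsOrd (galAdicCompletionMap (L := E') c₁ hw₁) α (toPlace w.1 w₁ ϖ ^ j) lam then
          ∑ᶠ Λ ∈ levelSetDep (galAdicCompletionMap (L := E') c₁ hw₁) Θ α (toPlace w.1 w₁ ϖ) h j b (lam - toPlace w.1 w₁ ((((localNonsplitEquiv (IsCMField.complexConj L) (Matrix.of fun i j : Fin 1 => if i.val + j.val + 1 = 1 then (1 : L) else 0) (IsCMField.complexConj_ne_one L) w hw γH.2).val : GL (Fin 1) (w.1.adicCompletion L)) : Matrix (Fin 1) (Fin 1) (w.1.adicCompletion L)) 0 0)), f b j Λ else 0) =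
      (if IsOrd (galAdicCompletionMap (L := E') c₁ hw₁) α (toPlace w.1 w₁ ϖ ^ j) lam then
          Nat.card 𝓀[(w.1.adicCompletion L)] ^ b * (levelSetDep (galAdicCompletionMap (L := E') c₁ hw₁) Θ α (toPlace w.1 w₁ ϖ) h j b (lam - toPlace w.1 w₁ ((((localNonsplitEquiv (IsCMField.complexConj L) (Matrix.of fun i j : Fin 1 => if i.val + j.val + 1 = 1 then (1 : L) else 0) (IsCMField.complexConj_ne_one L) w hw γH.2).val : GL (Fin 1) (w.1.adicCompletion L)) : Matrix (Fin 1) (Fin 1) (w.1.adicCompletion L)) 0 0))).ncard else 0) := by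
    intro b hb j _
    split_ifs with hlamj
    · exact finsum_levelSetDep_weight_eq_pow_mul_ncard (galAdicCompletionMap (L := L) (IsCMField.complexConj L) hw) hσ hvσ hϖ hD h2v hH₂σ (hW := (1 : (w.1.adicCompletion L))) (by rw [map_one]) (map_one _)
        (toPlace w.1 w₁) hρρ hvρ hα hα1 hint hΘΘ hΘρ hvΘ hΘj hjv hjfix hjpow hϖmax φ hφs hφi hφo hφγ hlam hΘh hh hform z hz1 ξ hzξ hσξ hξN
        ((((localNonsplitEquiv (IsCMField.complexConj L) (Matrix.of fun i j : Fin 1 => if i.val + j.val + 1 = 1 then (1 : L) else 0) (IsCMField.complexConj_ne_one L) w hw γH.2).val : GL (Fin 1) (w.1.adicCompletion L)) : Matrix (Fin 1) (Fin 1) (w.1.adicCompletion L)) 0 0) (Finset.mem_Icc.1 hb).1 hlamj (hfinLS j b) f (by simpa only [map_one] using hf)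
    · rfl
  have hconeM : ∀ b ∈ Finset.Icc 1 R', ∀ j ∈ Finset.range (J + 1),
      (if IsOrd (galAdicCompletionMap (L := E') c₁ hw₁) α (toPlace w.1 w₁ ϖ ^ j) lam then
          ∑ᶠ Λ ∈ levelSetDep (galAdicCompletionMap (L := E') c₁ hw₁) Θ α (toPlace w.1 w₁ ϖ) h' j b (lam - toPlace w.1 w₁ ((((localNonsplitEquiv (IsCMField.complexConj L) (Matrix.of fun i j : Fin 1 => if i.val + j.val + 1 = 1 then (1 : L) else 0) (IsCMField.complexConj_ne_one L) w hw γH.2).val : GL (Fin 1) (w.1.adicCompletion L)) : Matrix (Fin 1) (Fin 1) (w.1.adicCompletion L)) 0 0)), f' b j Λ else 0) =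
      (if IsOrd (galAdicCompletionMap (L := E') c₁ hw₁) α (toPlace w.1 w₁ ϖ ^ j) lam then
          Nat.card 𝓀[(w.1.adicCompletion L)] ^ b * (levelSetDep (galAdicCompletionMap (L := E') c₁ hw₁) Θ α (toPlace w.1 w₁ ϖ) h' j b (lam - toPlace w.1 w₁ ((((localNonsplitEquiv (IsCMField.complexConj L) (Matrix.of fun i j : Fin 1 => if i.val + j.val + 1 = 1 then (1 : L) else 0) (IsCMField.complexConj_ne_one L) w hw γH.2).val : GL (Fin 1) (w.1.adicCompletion L)) : Matrix (Fin 1) (Fin 1) (w.1.adicCompletion L)) 0 0))).ncard else 0) := by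
    intro b hb j _
    split_ifs with hlamj
    · exact finsum_levelSetDep_weight_eq_pow_mul_ncard (galAdicCompletionMap (L := L) (IsCMField.complexConj L) hw) hσ hvσ hϖ hD h2v hDgσ hη1 hησ
        (toPlace w.1 w₁) hρρ hvρ hα hα1 hint hΘΘ hΘρ hvΘ hΘj hjv hjfix hjpow hϖmax φ' hφ's hφ'i hφ'o hφ'γ hlam hΘh' hh' hform' z hz1 ξ hzξ hσξ hξN
        ((((localNonsplitEquiv (IsCMField.complexConj L) (Matrix.of fun i j : Fin 1 => if i.val + j.val + 1 = 1 then (1 : L) else 0) (IsCMField.complexConj_ne_one L) w hw γH.2).val : GL (Fin 1) (w.1.adicCompletion L)) : Matrix (Fin 1) (Fin 1) (w.1.adicCompletion L)) 0 0) (Finset.mem_Icc.1 hb).1 hlamj (hfinLS' j b) f' hf'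
    · rfl
  rw [Finset.sum_congr rfl fun b hb => Finset.sum_congr rfl fun j hj => hconeP b hb j hj,
    Finset.sum_congr rfl fun b hb => Finset.sum_congr rfl fun j hj => hconeM b hb j hj]
  exact key

end Summit.HodgeConjecture.HodgeConjecture.Cruxes.H413.F0P3cDyRamFixedPointCensusTypeTwoCensusOfOrderCountsV3

end
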